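import Summits.SmoothPoincare4.SmoothPoincare4.Theorems.ConvexBisectionAcyclicBisectionExistsBaseReflectionMap
import Mathlib.RingTheory.Complex
import Mathlib.LinearAlgebra.Complex.Determinant
import Mathlib.LinearAlgebra.Matrix.SchurComplement
import HarnessLib

/-!
# The fibred orientation-reversing involution of the Lefschetz base, II: its differential and
# `det dσ = -1`
(wave 2, node "fibred orientation-reversing involution `σ` of `Base g`" of stub
`stub_steinRealisation` = NF6, line `modp-braid-orbits` r11, crux
`ConvexBisection.AcyclicBisectionExists`, item stmt-SmoothPoincare4-10508; registered sub-goal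
`helper_det_fderiv_baseReflectionAmb`)

Sequel of `…BaseReflectionMap.lean` (`σ(x, y) = (λ(w) x̄, μ(w) ȳ)`, `λ = e^{2ia/(2g+1)}`,
`μ = e^{ia}`, `a = arg(1 + w)` on the region `Re w > -5/8`).

* §3 **the differential** (product rule, valid on all of `ℝ⁴`):
  `dσ_p = A_p + u_p ⊗ f_p`, `A_p V = (λ x̄_V, μ ȳ_V)` the antilinear part (`reflAnti`, an
  involution, real-orthogonal), `u_p = (2iλx̄/(2g+1), iμȳ)` the vertical vector (`reflVert`, the
  `a`-derivative of `(e^{2ia/(2g+1)} x̄, e^{ia} ȳ)`) and `f_p = da ∘ dw_p` (`reflForm`;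
  `da_z(h) = Im(h/(1+z))` on the region, `fderiv_reflArg_apply`).  On page tangents
  (`dΦ_p(V) = 0`) the correction vanishes: `dσ_p V = A_p V`
  (`fderiv_baseReflectionAmb_apply_of_dPhi_eq_zero`), whence
  `⟪dσ V, i dσ T⟫ = -⟪V, i T⟫` for `V, T ∈ ker dΦ_p` (`inner_fderiv_baseReflectionAmb_cplxJ`).
* §4 **orientation**: `det A_p = (-‖λ‖²)(-‖μ‖²) = 1` (complex conjugation of `ℂ²` PRESERVES the
  orientation; `det (a ↦ c ā) = -‖c‖²` from `Algebra.norm ℝ = normSq` and `det conj = -1`,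
  transported to `ℝ⁴ ≃ ℂ × ℂ` by `LinearMap.det_conj` / `det_prodMap`), and the reversal comes
  from the vertical correction: `dσ_p = A_p ∘ (1 + (A_p u_p) ⊗ f_p)` (`A_p² = 1`),
  `det(1 + x ⊗ f) = 1 + f(x)` (rank-one determinant lemma), `dw_p(A_p u_p) = -2i(1 + w)`, so
  `f_p(A_p u_p) = Im(-2i) = -2` and **`det dσ_p = -1`** on the region
  (`helper_det_fderiv_baseReflectionAmb`), in particular on `{rho ≤ 1/4} ⊇ Base g`.

Everything is proved; no named facts, no `sorry`.  Reference: J. B. Etnyre, T. Fuller, *Realizing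
4-manifolds as achiral Lefschetz fibrations*, IMRN 2006, §2 [EtnyreFuller2006].
-/

noncomputable section

set_option linter.dupNamespace false

open scoped Manifold ContDiff Topology ComplexConjugate
open Set Function Metric Complex
open Literature.Topology.FourManifolds Literature.Topology.FourManifolds.LefschetzBase

namespace Summit.SmoothPoincare4.SmoothPoincare4.Theorems.AcyclicBisectionExists.ModpBraidOrbits

variable {g : ℕ}

/-! ## §3 The differential of `σ`: antilinear part plus a rank-one vertical correction -/

/-- On the region, the fibre angle has differential `h ↦ Im (h / (1 + w))` (the differential of
`arg = Im log` on the slit plane). [folklore] -/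
theorem hasFDerivAt_reflArg {z : ℂ} (hz : -5 / 8 < z.re) :
    HasFDerivAt reflArg (Complex.imCLM.comp
      ((ContinuousLinearMap.smulRight (1 : ℂ →L[ℂ] ℂ) (1 / (1 + z))).restrictScalars ℝ)) z := by
  have h1 : HasDerivAt (fun t : ℂ => log (1 + t)) (1 / (1 + z)) z :=
    ((hasDerivAt_id z).const_add 1).clog (one_add_mem_slitPlane (show -1 < z.re by linarith))
  have h2 : HasFDerivAt (fun t : ℂ => (log (1 + t)).im) (Complex.imCLM.comp
      ((ContinuousLinearMap.smulRight (1 : ℂ →L[ℂ] ℂ) (1 / (1 + z))).restrictScalars ℝ)) z :=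
    Complex.imCLM.hasFDerivAt.comp z (h1.hasFDerivAt.restrictScalars ℝ)
  refine h2.congr_of_eventuallyEq ?_
  have ho : IsOpen {t : ℂ | -5 / 8 < t.re} := isOpen_lt continuous_const Complex.continuous_re
  filter_upwards [ho.mem_nhds hz] with t ht
  rw [reflArg_eq_arg (le_of_lt ht), log_im]

/-- **`d a_z (h) = Im (h / (1 + z))` on the region.** [folklore] -/
theorem fderiv_reflArg_apply {z : ℂ} (hz : -5 / 8 < z.re) (h : ℂ) :
    fderiv ℝ reflArg z h = (h / (1 + z)).im := by
  rw [(hasFDerivAt_reflArg hz).fderiv]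
  simp [div_eq_mul_one_div h]

/-- `ℝ⁴ ≃ ℂ × ℂ`, `V ↦ (x_V, y_V)`, with inverse `(a, b) ↦ mk a b` (real-linear). [folklore] -/
def cxyEquiv : EuclideanSpace ℝ (Fin 4) ≃ₗ[ℝ] ℂ × ℂ where
  toFun V := (cx V, cy V)
  invFun z := mk z.1 z.2
  map_add' V U := by simp [cx_add, cy_add]
  map_smul' t V := by simp [cx_smul, cy_smul, Complex.real_smul]
  left_inv V := mk_cx_cy V
  right_inv z := by simp

/-- `(a, b) ↦ mk a b` as a continuous linear map. [folklore] -/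
def mkCLM : ℂ × ℂ →L[ℝ] EuclideanSpace ℝ (Fin 4) :=
  LinearMap.toContinuousLinearMap cxyEquiv.symm.toLinearMap

/-- `mkCLM (a, b) = mk a b`. [folklore] -/
@[simp] theorem mkCLM_apply (z : ℂ × ℂ) : mkCLM z = mk z.1 z.2 := rfl

/-- `a ↦ c · ā` as a real-linear map of `ℂ`. [folklore] -/
def mulConj (c : ℂ) : ℂ →ₗ[ℝ] ℂ :=
  (Algebra.lmul ℝ ℂ c) ∘ₗ Complex.conjAe.toLinearEquiv.toLinearMap

/-- `mulConj c a = c · ā`. [folklore] -/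
@[simp] theorem mulConj_apply (c a : ℂ) : mulConj c a = c * conj a := rfl

/-- `det (a ↦ c ā) = -‖c‖²` (a reflection followed by a similarity). [folklore] -/
theorem det_mulConj (c : ℂ) : LinearMap.det (mulConj c) = -Complex.normSq c := by
  rw [mulConj, LinearMap.det_comp, ← Algebra.norm_apply, Algebra.norm_complex_apply, Complex.det_conjAe]
  ring

/-- **The antilinear part `A_p` of `dσ_p`**: `V ↦ (λ x̄_V, μ ȳ_V)` (`λ`, `μ` frozen at `w(p)`), as a
real-linear map of `ℝ⁴` (conjugate of `mulConj λ × mulConj μ` by `cxyEquiv`). [folklore] -/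
def reflAntiL (g : ℕ) (p : EuclideanSpace ℝ (Fin 4)) :
    EuclideanSpace ℝ (Fin 4) →ₗ[ℝ] EuclideanSpace ℝ (Fin 4) :=
  (cxyEquiv.symm : ℂ × ℂ →ₗ[ℝ] EuclideanSpace ℝ (Fin 4)) ∘ₗ
    ((mulConj (reflLam g (w g p))).prodMap (mulConj (reflMu (w g p)))) ∘ₗ
      (cxyEquiv.symm.symm : EuclideanSpace ℝ (Fin 4) →ₗ[ℝ] ℂ × ℂ)

/-- The antilinear part `A_p` of `dσ_p` as a continuous linear map. [folklore] -/
def reflAnti (g : ℕ) (p : EuclideanSpace ℝ (Fin 4)) :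
    EuclideanSpace ℝ (Fin 4) →L[ℝ] EuclideanSpace ℝ (Fin 4) :=
  LinearMap.toContinuousLinearMap (reflAntiL g p)

/-- `A_p V = (λ x̄_V, μ ȳ_V)`. [folklore] -/
theorem reflAnti_apply (p V : EuclideanSpace ℝ (Fin 4)) :
    reflAnti g p V = mk (reflLam g (w g p) * conj (cx V)) (reflMu (w g p) * conj (cy V)) := rfl

/-- `x`-coordinate of `A_p V`. [folklore] -/
@[simp] theorem cx_reflAnti (p V : EuclideanSpace ℝ (Fin 4)) :
    cx (reflAnti g p V) = reflLam g (w g p) * conj (cx V) := by rw [reflAnti_apply, cx_mk]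

/-- `y`-coordinate of `A_p V`. [folklore] -/
@[simp] theorem cy_reflAnti (p V : EuclideanSpace ℝ (Fin 4)) :
    cy (reflAnti g p V) = reflMu (w g p) * conj (cy V) := by rw [reflAnti_apply, cy_mk]

/-- `A_p` is an involution (`λ λ̄ = μ μ̄ = 1`). [folklore] -/
@[simp] theorem reflAnti_reflAnti (p V : EuclideanSpace ℝ (Fin 4)) : reflAnti g p (reflAnti g p V) = V := by
  refine ext_cx_cy ?_ ?_
  · rw [cx_reflAnti, cx_reflAnti, map_mul, Complex.conj_conj, ← mul_assoc, reflLam_mul_conj, one_mul]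
  · rw [cy_reflAnti, cy_reflAnti, map_mul, Complex.conj_conj, ← mul_assoc, reflMu_mul_conj, one_mul]

/-- **`det A_p = 1`**: complex conjugation of `ℂ²` preserves the orientation
(`det = (-‖λ‖²) · (-‖μ‖²) = 1`). [folklore] -/
theorem det_reflAnti (p : EuclideanSpace ℝ (Fin 4)) :
    LinearMap.det (reflAnti g p : EuclideanSpace ℝ (Fin 4) →ₗ[ℝ] EuclideanSpace ℝ (Fin 4)) = 1 := by
  show LinearMap.det (reflAntiL g p) = 1
  rw [reflAntiL, LinearMap.det_conj, LinearMap.det_prodMap, det_mulConj, det_mulConj,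
    Complex.normSq_eq_norm_sq, Complex.normSq_eq_norm_sq, norm_reflLam, norm_reflMu]
  norm_num

/-- **The vertical vector `u_p = (2i λ x̄ /(2g+1), i μ ȳ)`**: the `a`-derivative of
`(e^{2ia/(2g+1)} x̄, e^{ia} ȳ)`; `dw_p(A_p u_p) = -2i (1 + w)`. [folklore] -/
def reflVert (g : ℕ) (p : EuclideanSpace ℝ (Fin 4)) : EuclideanSpace ℝ (Fin 4) :=
  mk (((2 / (2 * g + 1) : ℝ) : ℂ) * I * reflLam g (w g p) * conj (cx p)) (I * reflMu (w g p) * conj (cy p))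

/-- **The real linear form `f_p = da ∘ dw_p`** of the rank-one correction. [folklore] -/
def reflForm (g : ℕ) (p : EuclideanSpace ℝ (Fin 4)) : EuclideanSpace ℝ (Fin 4) →L[ℝ] ℝ :=
  (fderiv ℝ reflArg (w g p)).comp (fderiv ℝ (w g) p)

/-- `f_p(V) = da_{w(p)} (dΦ_p(V))`, `dΦ_p(V) = a x_V + b y_V`. [folklore] -/
theorem reflForm_apply (p V : EuclideanSpace ℝ (Fin 4)) :
    reflForm g p V = fderiv ℝ reflArg (w g p) (dPhiX g p * cx V + dPhiY p * cy V) := by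
  rw [reflForm, ContinuousLinearMap.comp_apply, fderiv_w_apply]

/-- **The differential of `σ`**: `dσ_p = A_p + u_p ⊗ f_p`, i.e.
`dσ_p(V) = (λ x̄_V, μ ȳ_V) + da(dΦ_p V) · u_p` (product rule; valid on all of `ℝ⁴`). [folklore] -/
theorem hasFDerivAt_baseReflectionAmb (p : EuclideanSpace ℝ (Fin 4)) :
    HasFDerivAt (baseReflectionAmb g)
      (reflAnti g p + (reflForm g p).smulRight (reflVert g p)) p := by
  have hw : HasFDerivAt (w g) (fderiv ℝ (w g) p) p :=
    ((contDiff_w g).differentiable (by simp) p).hasFDerivAt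
  have ha : HasFDerivAt (fun q => reflArg (w g q)) (reflForm g p) p :=
    ((contDiff_reflArg.differentiable (by simp)) _).hasFDerivAt.comp p hw
  -- the unimodular factors through `w`
  have hmu : HasFDerivAt (fun q => reflMu (w g q))
      (reflMu (w g p) • (I • Complex.ofRealCLM.comp (reflForm g p))) p :=
    ((Complex.ofRealCLM.hasFDerivAt.comp p ha).mul_const I).cexp
  have hlam : HasFDerivAt (fun q => reflLam g (w g q))
      (reflLam g (w g p) • (I • Complex.ofRealCLM.comp ((2 / (2 * g + 1) : ℝ) • reflForm g p))) p :=
    ((Complex.ofRealCLM.hasFDerivAt.comp p (ha.const_mul (2 / (2 * g + 1) : ℝ))).mul_const I).cexp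
  -- the conjugated coordinates
  have hcx : HasFDerivAt (fun q : EuclideanSpace ℝ (Fin 4) => conj (cx q))
      ((Complex.conjCLE : ℂ →L[ℝ] ℂ).comp cxL) p := by
    have e : (fun q : EuclideanSpace ℝ (Fin 4) => conj (cx q)) = fun q => Complex.conjCLE (cxL q) := by
      funext q; rw [cxL_apply]; rfl
    rw [e]
    exact Complex.conjCLE.hasFDerivAt.comp p cxL.hasFDerivAt
  have hcy : HasFDerivAt (fun q : EuclideanSpace ℝ (Fin 4) => conj (cy q))
      ((Complex.conjCLE : ℂ →L[ℝ] ℂ).comp cyL) p := by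
    have e : (fun q : EuclideanSpace ℝ (Fin 4) => conj (cy q)) = fun q => Complex.conjCLE (cyL q) := by
      funext q; rw [cyL_apply]; rfl
    rw [e]
    exact Complex.conjCLE.hasFDerivAt.comp p cyL.hasFDerivAt
  have hσ := mkCLM.hasFDerivAt.comp p ((hlam.mul hcx).prodMk (hmu.mul hcy))
  refine HasFDerivAt.congr_fderiv hσ ?_
  refine ContinuousLinearMap.ext fun V => ext_cx_cy ?_ ?_
  · simp [cx_add, cx_smul, reflVert]
    ring
  · simp [cy_add, cy_smul, reflVert]
    ring

/-- The differential of `σ`, as an `fderiv`. [folklore] -/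
theorem fderiv_baseReflectionAmb (p : EuclideanSpace ℝ (Fin 4)) :
    fderiv ℝ (baseReflectionAmb g) p = reflAnti g p + (reflForm g p).smulRight (reflVert g p) :=
  (hasFDerivAt_baseReflectionAmb p).fderiv

/-- **`dσ_p(V) = A_p V` for `V` in the kernel of `dΦ_p`** (page tangents: the correction is
vertical only). [folklore] -/
theorem fderiv_baseReflectionAmb_apply_of_dPhi_eq_zero {p V : EuclideanSpace ℝ (Fin 4)}
    (hV : dPhiX g p * cx V + dPhiY p * cy V = 0) :
    fderiv ℝ (baseReflectionAmb g) p V = reflAnti g p V := by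
  rw [fderiv_baseReflectionAmb]
  show reflAnti g p V + reflForm g p V • reflVert g p = _
  rw [reflForm_apply, hV, map_zero, zero_smul, add_zero]

/-! ## §4 Orientation: `det dσ = -1` near the base -/

/-- **Rank-one determinant lemma** `det (1 + x ⊗ f) = 1 + f x`
(`Matrix.det_one_add_replicateCol_mul_replicateRow` in a basis). [folklore] -/
theorem det_one_add_smulRight' {V : Type*} [AddCommGroup V] [Module ℝ V] [FiniteDimensional ℝ V]
    (f : V →ₗ[ℝ] ℝ) (x : V) : LinearMap.det (1 + f.smulRight x) = 1 + f x := by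
  -- adapted from Literature/Analysis/FluidPDE/CollisionCylinder.lean (`LinearMap.det_one_add_smulRight`)
  classical
  let b := Module.finBasis ℝ V
  rw [← LinearMap.det_toMatrix b, map_add, LinearMap.toMatrix_one, LinearMap.toMatrix_smulRight,
    Matrix.vecMulVec_eq (Fin 1), Matrix.det_one_add_replicateCol_mul_replicateRow]
  congr 1
  calc (f ∘ b) ⬝ᵥ (b.repr x) = ∑ i, (b.repr x) i * f (b i) := by
        simp [dotProduct, mul_comm]
    _ = f (∑ i, (b.repr x) i • b i) := by rw [_root_.map_sum]; simp
    _ = f x := by rw [b.sum_repr]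

/-- `x (A_p u_p) = -2i x / (2g+1)`. [folklore] -/
theorem cx_reflAnti_reflVert (p : EuclideanSpace ℝ (Fin 4)) :
    cx (reflAnti g p (reflVert g p)) = -((2 / (2 * g + 1) : ℝ) : ℂ) * I * cx p := by
  rw [cx_reflAnti]
  simp only [reflVert, cx_mk, map_mul, Complex.conj_conj, Complex.conj_I, Complex.conj_ofReal]
  linear_combination (-((2 / (2 * g + 1) : ℝ) : ℂ) * I * cx p) * reflLam_mul_conj g (w g p)

/-- `y (A_p u_p) = -i y`. [folklore] -/
theorem cy_reflAnti_reflVert (p : EuclideanSpace ℝ (Fin 4)) :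
    cy (reflAnti g p (reflVert g p)) = -I * cy p := by
  rw [cy_reflAnti]
  simp only [reflVert, cy_mk, map_mul, Complex.conj_conj, Complex.conj_I]
  linear_combination (-I * cy p) * reflMu_mul_conj (w g p)

/-- `dw_p(A_p u_p) = -2i (1 + w(p))`. [folklore] -/
theorem fderiv_w_reflAnti_reflVert (p : EuclideanSpace ℝ (Fin 4)) :
    fderiv ℝ (w g) p (reflAnti g p (reflVert g p)) = -2 * I * (1 + w g p) := by
  rw [fderiv_w_apply, cx_reflAnti_reflVert, cy_reflAnti_reflVert, dPhiX, dPhiY]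
  have h3 : (2 * (g : ℂ) + 1) ≠ 0 := by norm_cast
  have hw : 1 + w g p = cy p ^ 2 - cx p ^ (2 * g + 1) := by simp only [w, Phi]; ring
  rw [hw]
  push_cast
  field_simp
  ring

/-- `f_p (A_p u_p) = -2` on the region. [folklore] -/
theorem reflForm_reflAnti_reflVert {p : EuclideanSpace ℝ (Fin 4)} (hp : p ∈ reflRegion g) :
    reflForm g p (reflAnti g p (reflVert g p)) = -2 := by
  rw [reflForm, ContinuousLinearMap.comp_apply, fderiv_w_reflAnti_reflVert, fderiv_reflArg_apply hp]
  have h : (1 + w g p) ≠ 0 := slitPlane_ne_zero (one_add_mem_slitPlane (by have := hp.out; linarith))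
  rw [mul_div_assoc, div_self h, mul_one]
  simp

/-- **Sub-goal `helper_det_fderiv_baseReflectionAmb`** (NF6, node "fibred orientation-reversing
involution", lead c5 wave 2): **`σ` reverses the orientation of `ℂ²` near the base**:
`det dσ_p = -1` whenever `Re w(p) > -5/8` (so on `{rho ≤ 1/4} ⊇ Base g`).  Proof:
`dσ_p = A_p ∘ (1 + (A_p u_p) ⊗ f_p)` (`A_p² = 1`), `det A_p = 1`, `det (1 + (A_p u_p) ⊗ f_p) =
1 + f_p(A_p u_p) = 1 − 2`. [folklore] -/
theorem helper_det_fderiv_baseReflectionAmb : ∀ (g : ℕ) (p : EuclideanSpace ℝ (Fin 4)),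
    -5 / 8 < (Literature.Topology.FourManifolds.LefschetzBase.w g p).re →
    (fderiv ℝ (Summit.SmoothPoincare4.SmoothPoincare4.Theorems.AcyclicBisectionExists.ModpBraidOrbits.baseReflectionAmb g) p).det = -1 := by
  intro g p hp
  rw [fderiv_baseReflectionAmb]
  have hfac : ((reflAnti g p + (reflForm g p).smulRight (reflVert g p) :
      EuclideanSpace ℝ (Fin 4) →L[ℝ] EuclideanSpace ℝ (Fin 4)) :
        EuclideanSpace ℝ (Fin 4) →ₗ[ℝ] EuclideanSpace ℝ (Fin 4)) =
      (reflAnti g p : EuclideanSpace ℝ (Fin 4) →ₗ[ℝ] EuclideanSpace ℝ (Fin 4)) ∘ₗ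
        (1 + (reflForm g p : EuclideanSpace ℝ (Fin 4) →ₗ[ℝ] ℝ).smulRight (reflAnti g p (reflVert g p))) := by
    refine LinearMap.ext fun V => ?_
    simp [map_add, map_smul]
  show LinearMap.det _ = -1
  rw [hfac, LinearMap.det_comp, det_reflAnti, det_one_add_smulRight', one_mul]
  show 1 + reflForm g p (reflAnti g p (reflVert g p)) = -1
  rw [reflForm_reflAnti_reflVert hp]
  norm_num

/-- **`σ` reverses the orientation on `{rho ≤ 1/4}`** (in particular at every point of `Base g`).
[folklore] -/
theorem det_fderiv_baseReflectionAmb_of_rho_le {p : EuclideanSpace ℝ (Fin 4)} (hp : rho g p ≤ 1 / 4) :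
    (fderiv ℝ (baseReflectionAmb g) p).det = -1 :=
  helper_det_fderiv_baseReflectionAmb g p (mem_reflRegion_of_rho_le hp)

/-- `σ` reverses the orientation on `{rho ≤ 1/4}`: `det dσ < 0`. [folklore] -/
theorem det_fderiv_baseReflectionAmb_neg {p : EuclideanSpace ℝ (Fin 4)} (hp : rho g p ≤ 1 / 4) :
    (fderiv ℝ (baseReflectionAmb g) p).det < 0 := by
  rw [det_fderiv_baseReflectionAmb_of_rho_le hp]; norm_num

/-- **`dσ` reverses the pairing with `i T` on page tangents**: for `V`, `T` in `ker dΦ_p`,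
`⟪dσ_p V, i dσ_p T⟫ = -⟪V, i T⟫` (`dσ = A` there, and `A` is antilinear and real-orthogonal).
[folklore] -/
theorem inner_fderiv_baseReflectionAmb_cplxJ {p V T : EuclideanSpace ℝ (Fin 4)}
    (hV : dPhiX g p * cx V + dPhiY p * cy V = 0) (hT : dPhiX g p * cx T + dPhiY p * cy T = 0) :
    inner ℝ (fderiv ℝ (baseReflectionAmb g) p V) (cplxJ (fderiv ℝ (baseReflectionAmb g) p T)) =
      -inner ℝ V (cplxJ T) := by
  rw [fderiv_baseReflectionAmb_apply_of_dPhi_eq_zero hV, fderiv_baseReflectionAmb_apply_of_dPhi_eq_zero hT,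
    inner_cplxJ, inner_cplxJ, cx_reflAnti, cy_reflAnti, cx_reflAnti, cy_reflAnti]
  have key : reflLam g (w g p) * conj (cx V) * conj (reflLam g (w g p) * conj (cx T)) +
      reflMu (w g p) * conj (cy V) * conj (reflMu (w g p) * conj (cy T)) =
      conj (cx V * conj (cx T) + cy V * conj (cy T)) := by
    simp only [map_mul, map_add, Complex.conj_conj]
    linear_combination (conj (cx V) * cx T) * reflLam_mul_conj g (w g p) +
      (conj (cy V) * cy T) * reflMu_mul_conj (w g p)
  rw [key, Complex.conj_im]

end Summit.SmoothPoincare4.SmoothPoincare4.Theorems.AcyclicBisectionExists.ModpBraidOrbits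

end
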